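import Summits.Ventures.PercRepro.ProfilePointedCircuitClassesStarNineSplitH

/-!
# PercRepro — THE TWO-PART SPLIT OF THE DEFECT BOUND, PART I: THE UNCONDITIONAL CANDIDATE DOUBLE COUNT
(p5, gen 58; `proofs/P5-GM1.md` §86 ADD 5(c))

Part F's two degree bounds need no hypothesis on `e` or `f`: every first-kind defect has `≥ 2` candidate pairs inside
it, and a candidate `π` lies in `≤ 5 − cS(π)` first-kind defects.  Hence, on every simple cosimple `N` with `#E = 9`:
**`2·#tTwo ≤ Σ_{π ∈ cands} (5 − cS π)`** (`two_mul_card_tTwo_le_sum`).  The first-kind bound `#tTwo ≤ #cPairs + #fDep`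
therefore follows from `Σ_{π ∈ cands} (5 − cS π) ≤ 2·#cPairs + 2·#fDep` (`inCount_le_of_sum_bound`) — the general form
of the kill bound; the census shows it is NOT always true (it fails where a `3`-circuit through `e` makes `cS π = 2`
while `π` lies in fewer than three defects), so the residual of §86 ADD 5 needs the actual defect structure.
-/

open scoped Matroid

namespace PercRepro.Cogirth

open Finset ThmH Skew Shadow Profile

open Classical

variable {α : Type} [DecidableEq α] {N : Matroid α} [N.Finite]

section StarNineSplitI

/-- **THE UNCONDITIONAL CANDIDATE DOUBLE COUNT**: `2·#tTwo ≤ Σ_{π ∈ cands} (5 − cS π)`. -/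
theorem two_mul_card_tTwo_le_sum (hn : (gr N).card = 9)
    (hcos : ∀ x ∈ gr N, ∀ y ∈ gr N, x ≠ y → rk N (((gr N).erase x).erase y) = 5) {e f : α} (he : e ∈ gr N)
    (hf : f ∈ gr N) (hef : e ≠ f) :
    2 * (tTwo N e f).card ≤ ∑ π ∈ cands N e f, (5 - cS N e f π) := by
  have hdc := sum_card_bipartiteAbove_eq_sum_card_bipartiteBelow (fun (τ π : Finset α) => π ⊆ τ)
    (s := tTwo N e f) (t := cands N e f)
  have hlow : (tTwo N e f).card • 2 ≤
      ∑ τ ∈ tTwo N e f, (bipartiteAbove (fun τ π => π ⊆ τ) (cands N e f) τ).card := by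
    apply card_nsmul_le_sum
    intro τ hτ
    unfold bipartiteAbove
    exact two_le_card_cands_subset hn hcos he hf hef hτ
  have hup : ∑ π ∈ cands N e f, (bipartiteBelow (fun τ π => π ⊆ τ) (tTwo N e f) π).card ≤
      ∑ π ∈ cands N e f, (5 - cS N e f π) := by
    apply sum_le_sum
    intro π hπ
    rw [show bipartiteBelow (fun τ π => π ⊆ τ) (tTwo N e f) π = (tTwo N e f).filter (fun τ => π ⊆ τ) from rfl]
    have := card_tTwo_supset_le_five_sub_cS hn he hf hef hπ
    omega
  rw [hdc] at hlow
  have := hlow.trans hup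
  simp only [smul_eq_mul] at this
  omega

/-- **(★)₉ FROM THE SUM BOUND**: if `Σ_{π ∈ cands} (5 − cS π) ≤ 2·#cPairs + 2·#fDep`, then `in_4(e) ≤ in_4(f) + thru_4({e, f})`. -/
theorem inCount_le_of_sum_bound (hn : (gr N).card = 9)
    (hsimple : ∀ x ∈ gr N, ∀ y ∈ gr N, x ≠ y → rk N {x, y} = 2)
    (hcos : ∀ x ∈ gr N, ∀ y ∈ gr N, x ≠ y → rk N (((gr N).erase x).erase y) = 5) {e f : α} (he : e ∈ gr N)
    (hf : f ∈ gr N) (hef : e ≠ f)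
    (hsum : ∑ π ∈ cands N e f, (5 - cS N e f π) ≤ 2 * (cPairs N e f).card + 2 * (fDep N e f).card) :
    inCount N 4 e ≤ inCount N 4 f + thruCount N 4 {e, f} := by
  apply starNine_of_defect_bound hef
  apply defect_bound_of_tTwo_bound hn hsimple hcos he hf hef
  have := two_mul_card_tTwo_le_sum hn hcos he hf hef
  omega

end StarNineSplitI

end PercRepro.Cogirth
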